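import Mathlib

/-!
# `GrenetZeon.DualUnipotentThreeHalves` (stmt-ValiantsHypothesis-24318), LINE β `half_speed`, K1 (iii) step (3): RANK COMPRESSION of a key —
# the classes of a key `κ` on `range L` renumbered `0, 1, …, L′−1` in order (no empty coarse levels)

First inheritor val-port-2 g2 (desk #332; README §GROUPING (3)).  For `κ : ℕ → ℕ` and `L`: `keyImage := (range L).image κ`,
`rankOf v := #{w ∈ keyImage : w < v}`, coarse index `rank t := rankOf (κ t)`.  Facts: `rank` depends only on the key (`rank_eq_of_key_eq`),
is strictly monotone in the key on `range L` (`rank_lt_of_key_lt`), hence monotone in `t` when `κ` is (`rank_mono`), takes values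
`< L′ := #keyImage` (`rank_lt_card`), and hits EVERY value `< L′` (`rank_surj`) — so the coarse levels are exactly the key classes, none empty.

Honest framing.  Finite combinatorics (`--supports stmt-ValiantsHypothesis-24318 --as helper`); proves nothing about K1, `HalfSpeedIrrLaw`,
R2, the crux, 8062 or `VP ≠ VNP` — all OPEN / NOT proved.
-/

set_option linter.dupNamespace false
set_option autoImplicit false

namespace Summit.ValiantsHypothesis.ValiantsHypothesis.Theorems.GrenetZeon.HalfSpeed

section Rank

variable (κ : ℕ → ℕ) (L : ℕ)

/-- The set of key values on `range L`. -/
def keyImage : Finset ℕ := (Finset.range L).image κ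

/-- Rank of a value among the key values: the number of key values below it. -/
def rankOf (v : ℕ) : ℕ := ((keyImage κ L).filter fun w => w < v).card

/-- The coarse index of level `t`. -/
def rank (t : ℕ) : ℕ := rankOf κ L (κ t)

/-- Equal keys, equal ranks. -/
theorem rank_eq_of_key_eq {t t' : ℕ} (h : κ t = κ t') : rank κ L t = rank κ L t' := by
  unfold rank; rw [h]

/-- `rankOf` is monotone in the value. -/
theorem rankOf_mono {v w : ℕ} (h : v ≤ w) : rankOf κ L v ≤ rankOf κ L w := by
  unfold rankOf
  exact Finset.card_le_card fun x hx => by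
    rw [Finset.mem_filter] at hx ⊢; exact ⟨hx.1, lt_of_lt_of_le hx.2 h⟩

/-- `rankOf` is STRICTLY monotone at key values: `v ∈ keyImage`, `v < w` ⇒ `rankOf v < rankOf w`. -/
theorem rankOf_lt_of_lt {v w : ℕ} (hv : v ∈ keyImage κ L) (h : v < w) : rankOf κ L v < rankOf κ L w := by
  unfold rankOf
  apply Finset.card_lt_card
  rw [Finset.ssubset_iff_of_subset (fun x hx => by
    rw [Finset.mem_filter] at hx ⊢; exact ⟨hx.1, hx.2.trans h⟩)]
  exact ⟨v, by rw [Finset.mem_filter]; exact ⟨hv, h⟩, by simp⟩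

/-- Key values of levels `< L` lie in the key image. -/
theorem key_mem_keyImage {t : ℕ} (ht : t < L) : κ t ∈ keyImage κ L :=
  Finset.mem_image.2 ⟨t, Finset.mem_range.2 ht, rfl⟩

/-- Strict monotonicity of the coarse index in the key (on `range L`). -/
theorem rank_lt_of_key_lt {t t' : ℕ} (ht : t < L) (h : κ t < κ t') : rank κ L t < rank κ L t' :=
  rankOf_lt_of_lt κ L (key_mem_keyImage κ L ht) h

/-- The coarse index is monotone in `t` when the key is. -/
theorem rank_mono (hκ : ∀ t t', t ≤ t' → κ t ≤ κ t') {t t' : ℕ} (h : t ≤ t') : rank κ L t ≤ rank κ L t' :=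
  rankOf_mono κ L (hκ t t' h)

/-- Distinct keys on `range L` get distinct coarse indices. -/
theorem key_eq_of_rank_eq {t t' : ℕ} (ht : t < L) (ht' : t' < L) (h : rank κ L t = rank κ L t') : κ t = κ t' := by
  by_contra hne
  rcases lt_or_gt_of_ne hne with hlt | hgt
  · exact absurd h (rank_lt_of_key_lt κ L ht hlt).ne
  · exact absurd h (rank_lt_of_key_lt κ L ht' hgt).ne'

/-- The coarse index is `< L′ = #keyImage`. -/
theorem rank_lt_card {t : ℕ} (ht : t < L) : rank κ L t < (keyImage κ L).card := by
  unfold rank rankOf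
  apply Finset.card_lt_card
  rw [Finset.ssubset_iff_of_subset (Finset.filter_subset _ _)]
  exact ⟨κ t, key_mem_keyImage κ L ht, by simp⟩

/-- **Every coarse index `< L′` is attained** (no empty coarse level). -/
theorem rank_surj {s : ℕ} (hs : s < (keyImage κ L).card) : ∃ t, t < L ∧ rank κ L t = s := by
  classical
  -- rankOf is injective on keyImage, so its image has full size and fills `range #keyImage`
  have hinj : Set.InjOn (rankOf κ L) (keyImage κ L : Set ℕ) := by
    intro v hv w hw hvw
    by_contra hne
    rcases lt_or_gt_of_ne hne with hlt | hgt
    · exact absurd hvw (rankOf_lt_of_lt κ L hv hlt).ne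
    · exact absurd hvw (rankOf_lt_of_lt κ L hw hgt).ne'
  have hsub : (keyImage κ L).image (rankOf κ L) ⊆ Finset.range (keyImage κ L).card := by
    intro x hx
    obtain ⟨v, hv, rfl⟩ := Finset.mem_image.1 hx
    obtain ⟨t, ht, rfl⟩ := Finset.mem_image.1 hv
    exact Finset.mem_range.2 (rank_lt_card κ L (Finset.mem_range.1 ht))
  have hcard : ((keyImage κ L).image (rankOf κ L)).card = (Finset.range (keyImage κ L).card).card := by
    rw [Finset.card_image_of_injOn hinj, Finset.card_range]
  have heq := Finset.eq_of_subset_of_card_le hsub hcard.ge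
  have hs' : s ∈ (keyImage κ L).image (rankOf κ L) := by rw [heq]; exact Finset.mem_range.2 hs
  obtain ⟨v, hv, hvs⟩ := Finset.mem_image.1 hs'
  obtain ⟨t, ht, rfl⟩ := Finset.mem_image.1 hv
  exact ⟨t, Finset.mem_range.1 ht, hvs⟩

/-- `L′ ≤ L`: there are at most `L` classes. -/
theorem card_keyImage_le : (keyImage κ L).card ≤ L := by
  unfold keyImage
  exact Finset.card_image_le.trans (Finset.card_range L).le

end Rank

end Summit.ValiantsHypothesis.ValiantsHypothesis.Theorems.GrenetZeon.HalfSpeed
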